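import Mathlib.Analysis.Calculus.BumpFunction.Convolution
import Mathlib.Analysis.Calculus.BumpFunction.FiniteDimension
import Literature.MathematicalPhysics.QuantumFieldTheory.LatticeGaugeDobrushinPoincare
import HarnessLib

/-!
# Shen–Zhu–Zhu from the one-link Poincaré inequality for SMOOTH observables

Literature support file for the named fact
`Literature.MathematicalPhysics.QuantumFieldTheory.shen_zhu_zhu` (Shen–Zhu–Zhu, *A stochastic
analysis approach to lattice Yang–Mills at strong coupling*, CMP 400 (2023) 805–851,
arXiv:2204.12737: uniqueness of the `SU(N)` lattice Yang–Mills DLR state and exponential decay of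
covariances for `|β| < 1/(16(d-1))`, `N`-uniformly).

`shen_zhu_zhu_of_haarPoincare` (file `LatticeGaugeDobrushinPoincare`) reduced the fact to the
single-group input

  `hLP`: for `N ≥ 2`, `‖B‖_op < 1/2` and every `ψ : SU(N) → ℝ` with
  `|ψ a - ψ b| ≤ M ‖a - b‖_F`, `Var_{ν_B}(ψ) ≤ M² / (N (1/2 - ‖B‖_op))`,
  `ν_B = Z⁻¹ exp(N Re tr(g B)) dHaar(g)`,

the Bakry–Émery Poincaré inequality for the one-link measure in Lipschitz form.  This file performs
the first, purely analytic, step of the proof of `hLP`: **it suffices to know the variance bound for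
observables that are restrictions to `SU(N)` of smooth (`C^∞`) globally `M`-Lipschitz functions on
the ambient real vector space `M_N(ℂ)`** (`shen_zhu_zhu_of_smoothPoincare`).  This is the form in
which the Bakry–Émery argument (Γ₂-calculus for smooth functions, Shen–Zhu–Zhu §4.1, (4.7) /
Bakry–Gentil–Ledoux Prop. 4.8.1) delivers the inequality, with `|∇f|² ≤ ‖Df‖_op² ≤ M²`.

The reduction is McShane extension plus mollification:
* `exists_contDiff_lipschitzWith_dist_le`: on a finite-dimensional real normed space, an
  `K`-Lipschitz real function is, for every `ε > 0`, uniformly `ε`-close to a `C^∞` function that is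
  again `K`-Lipschitz (convolution with a normed bump function of radius `ε/K`; the Lipschitz
  constant is preserved because the bump is a probability density) [folklore; e.g.
  Evans–Gariepy, *Measure theory and fine properties of functions*, §4.2 Thm. 1];
* `variance_le_of_forall_approx`: if a bounded observable `X` is, for every `ε > 0`, uniformly
  `ε`-close to an observable of variance `≤ V`, then `Var X ≤ V` [folklore];
* `shen_zhu_zhu_of_smoothPoincare`: extend `ψ` from `SU(N) ⊂ M_N(ℂ)` to an `M`-Lipschitz function
  for the Frobenius (= Euclidean) distance (`LipschitzOnWith.extend_real`, McShane), mollify, apply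
  the smooth hypothesis, and pass to the limit.

No new definitions, no new named facts; Mathlib's non-instance Frobenius norm structures
(`Matrix.frobeniusNormedAddCommGroup`, `Matrix.frobeniusNormedSpace`) are activated locally, as in
`LatticeGaugeDobrushinPoincare`, so that `ContDiff ℝ ∞ f` for `f : M_N(ℂ) → ℝ` refers to the
Euclidean structure of `M_N(ℂ) ≅ ℝ^{2N²}`.

## References
* H. Shen, R. Zhu, X. Zhu, CMP 400 (2023) 805–851, arXiv:2204.12737, §4.1–4.2. [cite: arXiv220412737]
* D. Bakry, I. Gentil, M. Ledoux, *Analysis and Geometry of Markov Diffusion Operators* (2014),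
  Prop. 4.8.1.
* L. C. Evans, R. F. Gariepy, *Measure Theory and Fine Properties of Functions* (1992), §4.2.
-/

open MeasureTheory ProbabilityTheory Filter Topology Function
open scoped ContDiff NNReal ENNReal Matrix Convolution

namespace Literature.MathematicalPhysics.QuantumFieldTheory

/-! ## Mollification preserves Lipschitz constants -/

section Mollify

variable {E : Type*} [NormedAddCommGroup E] [NormedSpace ℝ E] [FiniteDimensional ℝ E]

/-- On a finite-dimensional real normed space, a `K`-Lipschitz real function is uniformly
approximable by `C^∞` functions with the same Lipschitz constant: the convolution with a normed
smooth bump function of outer radius `δ` (`K δ ≤ ε`) is `C^∞`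
(`HasCompactSupport.contDiff_convolution_left`), `ε`-close
(`ContDiffBump.dist_normed_convolution_le`) and `K`-Lipschitz since the bump is a probability
density (Evans–Gariepy §4.2 Thm. 1). [folklore] -/
theorem exists_contDiff_lipschitzWith_dist_le {f : E → ℝ} {K : ℝ≥0} (hf : LipschitzWith K f)
    {ε : ℝ} (hε : 0 < ε) :
    ∃ g : E → ℝ, ContDiff ℝ ∞ g ∧ LipschitzWith K g ∧ ∀ x, dist (g x) (f x) ≤ ε := by
  borelize E
  set μ : Measure E := Measure.addHaar
  -- a radius `δ > 0` with `K δ ≤ ε`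
  obtain ⟨δ, hδ, hKδ⟩ : ∃ δ : ℝ, 0 < δ ∧ (K : ℝ) * δ ≤ ε := by
    refine ⟨ε / ((K : ℝ) + 1), div_pos hε (by positivity), ?_⟩
    rw [mul_div_assoc', div_le_iff₀ (by positivity)]
    nlinarith [K.coe_nonneg]
  let φ : ContDiffBump (0 : E) := ⟨δ / 2, δ, half_pos hδ, half_lt_self hδ⟩
  have hfc : Continuous f := hf.continuous
  refine ⟨φ.normed μ ⋆[ContinuousLinearMap.lsmul ℝ ℝ, μ] f, ?_, ?_, ?_⟩
  · exact φ.hasCompactSupport_normed.contDiff_convolution_left _ φ.contDiff_normed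
      (hfc.locallyIntegrable (μ := μ))
  · refine LipschitzWith.of_dist_le_mul fun x y => ?_
    have hint : ∀ z, Integrable (fun t => φ.normed μ t * f (z - t)) μ := fun z =>
      φ.hasCompactSupport_normed.convolutionExists_left_of_continuous_right
        (ContinuousLinearMap.lsmul ℝ ℝ) φ.integrable_normed.locallyIntegrable hfc z
    simp only [convolution_def, ContinuousLinearMap.lsmul_apply, smul_eq_mul]
    rw [dist_eq_norm, ← integral_sub (hint x) (hint y)]
    calc ‖∫ t, (φ.normed μ t * f (x - t) - φ.normed μ t * f (y - t)) ∂μ‖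
        ≤ ∫ t, ‖φ.normed μ t * f (x - t) - φ.normed μ t * f (y - t)‖ ∂μ :=
          norm_integral_le_integral_norm _
      _ ≤ ∫ t, φ.normed μ t * (K * dist x y) ∂μ := by
          refine integral_mono_of_nonneg (ae_of_all _ fun _ => norm_nonneg _)
            (φ.integrable_normed.mul_const _) (ae_of_all _ fun t => ?_)
          dsimp only
          rw [← mul_sub, norm_mul, Real.norm_of_nonneg (φ.nonneg_normed t), ← dist_eq_norm]
          refine mul_le_mul_of_nonneg_left ?_ (φ.nonneg_normed t)
          simpa only [dist_sub_right] using hf.dist_le_mul (x - t) (y - t)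
      _ = K * dist x y := by rw [integral_mul_const, φ.integral_normed, one_mul]
  · intro x
    exact φ.dist_normed_convolution_le hfc.aestronglyMeasurable fun y hy =>
      calc dist (f y) (f x) ≤ K * dist y x := hf.dist_le_mul y x
        _ ≤ K * δ := mul_le_mul_of_nonneg_left (le_of_lt (Metric.mem_ball.1 hy)) K.coe_nonneg
        _ ≤ ε := hKδ

end Mollify

/-! ## Variances of uniformly approximated observables -/

section VarianceApprox

variable {Ω : Type*} [MeasurableSpace Ω] {ν : Measure Ω} [IsProbabilityMeasure ν]

/-- If a bounded observable `X` is, for every `ε > 0`, uniformly `ε`-close to an observable `Y`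
with `Var Y ≤ V`, then `Var X ≤ V`: indeed `Var X ≤ E (X - E Y)² ≤ (1 + 1/η) ε² + (1 + η) Var Y`
for every `η > 0`. [folklore] -/
theorem variance_le_of_forall_approx {X : Ω → ℝ} (hXm : AEStronglyMeasurable X ν)
    (hXb : ∃ C, ∀ x, |X x| ≤ C) {V : ℝ}
    (h : ∀ ε, 0 < ε → ∃ Y : Ω → ℝ, AEStronglyMeasurable Y ν ∧ (∀ x, |X x - Y x| ≤ ε) ∧
      Var[Y; ν] ≤ V) :
    Var[X; ν] ≤ V := by
  obtain ⟨C, hC⟩ := hXb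
  -- `V ≥ 0`
  have hV : 0 ≤ V := by
    obtain ⟨Y, -, -, hY⟩ := h 1 one_pos
    exact (variance_nonneg Y ν).trans hY
  -- the two-parameter bound
  have key : ∀ η, 0 < η → ∀ ε, 0 < ε → Var[X; ν] ≤ (1 + 1 / η) * ε ^ 2 + (1 + η) * V := by
    intro η hη ε hε
    obtain ⟨Y, hYm, hXY, hYV⟩ := h ε hε
    set c : ℝ := ν[Y]
    have hYb : ∀ x, |Y x| ≤ C + ε := fun x => by
      have h1 := hC x
      have h2 := hXY x
      rw [abs_le] at h1 h2 ⊢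
      constructor <;> linarith
    -- `Var X = Var (X - c) ≤ E (X - c)²`
    have h1 : Var[X; ν] ≤ ∫ x, (X x - c) ^ 2 ∂ν := by
      rw [← variance_sub_const hXm c]
      exact variance_le_expectation_sq (hXm.sub aestronglyMeasurable_const)
    -- pointwise `(X - c)² ≤ (1 + 1/η)(X - Y)² + (1 + η)(Y - c)²`
    have h2 : ∀ x, (X x - c) ^ 2 ≤ (1 + 1 / η) * ε ^ 2 + (1 + η) * (Y x - c) ^ 2 := fun x => by
      have hab : ∀ a b : ℝ, (a + b) ^ 2 ≤ (1 + 1 / η) * a ^ 2 + (1 + η) * b ^ 2 := fun a b => by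
        have : 2 * a * b ≤ (1 / η) * a ^ 2 + η * b ^ 2 := by
          have h0 : 0 ≤ (a - η * b) ^ 2 / η := div_nonneg (sq_nonneg _) hη.le
          have : (a - η * b) ^ 2 / η = (1 / η) * a ^ 2 - 2 * a * b + η * b ^ 2 := by
            field_simp
            ring
          linarith
        nlinarith
      have hXYx : (X x - Y x) ^ 2 ≤ ε ^ 2 := by
        rw [← sq_abs]
        exact pow_le_pow_left₀ (abs_nonneg _) (hXY x) 2
      calc (X x - c) ^ 2 = ((X x - Y x) + (Y x - c)) ^ 2 := by ring
        _ ≤ (1 + 1 / η) * (X x - Y x) ^ 2 + (1 + η) * (Y x - c) ^ 2 := hab _ _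
        _ ≤ (1 + 1 / η) * ε ^ 2 + (1 + η) * (Y x - c) ^ 2 := by
            gcongr
    -- integrate
    have hYc_int : Integrable (fun x => (Y x - c) ^ 2) ν := by
      refine QuantumLattice.integrable_of_bound (C := (C + ε + |c|) ^ 2) ?_ fun x => ?_
      · exact (hYm.sub aestronglyMeasurable_const).pow 2
      · rw [abs_of_nonneg (sq_nonneg _), ← sq_abs]
        refine pow_le_pow_left₀ (abs_nonneg _) ?_ 2
        calc |Y x - c| ≤ |Y x| + |c| := abs_sub _ _
          _ ≤ C + ε + |c| := by linarith [hYb x]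
    have h3 : ∫ x, (X x - c) ^ 2 ∂ν ≤
        ∫ x, ((1 + 1 / η) * ε ^ 2 + (1 + η) * (Y x - c) ^ 2) ∂ν := by
      refine integral_mono_of_nonneg (ae_of_all _ fun x => sq_nonneg _) ?_ (ae_of_all _ h2)
      exact (integrable_const _).add (hYc_int.const_mul _)
    have h4 : ∫ x, ((1 + 1 / η) * ε ^ 2 + (1 + η) * (Y x - c) ^ 2) ∂ν =
        (1 + 1 / η) * ε ^ 2 + (1 + η) * Var[Y; ν] := by
      rw [integral_add (integrable_const _) (hYc_int.const_mul _), integral_const, integral_const_mul,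
        variance_eq_integral hYm.aemeasurable]
      simp [c]
    calc Var[X; ν] ≤ ∫ x, (X x - c) ^ 2 ∂ν := h1
      _ ≤ (1 + 1 / η) * ε ^ 2 + (1 + η) * Var[Y; ν] := h3.trans_eq h4
      _ ≤ (1 + 1 / η) * ε ^ 2 + (1 + η) * V := by gcongr
  -- let `ε → 0`, then `η → 0`
  have key' : ∀ η, 0 < η → Var[X; ν] ≤ η + (1 + η) * V := by
    intro η hη
    -- choose `ε ≤ 1` with `(1 + 1/η) ε² ≤ (1 + 1/η) ε ≤ η`
    set ε : ℝ := min 1 (η / (1 + 1 / η)) with hε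
    have hε0 : 0 < ε := lt_min one_pos (div_pos hη (by positivity))
    have hε1 : ε ≤ 1 := min_le_left _ _
    have hε2 : (1 + 1 / η) * ε ≤ η := by
      have : ε ≤ η / (1 + 1 / η) := min_le_right _ _
      rwa [le_div_iff₀ (by positivity), mul_comm] at this
    have hsq : (1 + 1 / η) * ε ^ 2 ≤ η := by
      calc (1 + 1 / η) * ε ^ 2 ≤ (1 + 1 / η) * ε := by
            refine mul_le_mul_of_nonneg_left ?_ (by positivity)
            nlinarith
        _ ≤ η := hε2
    linarith [key η hη ε hε0]
  -- conclude
  refine le_of_forall_pos_lt_add fun τ hτ => ?_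
  -- pick `η` with `η (1 + V) < τ`
  set η : ℝ := τ / (2 * (1 + V)) with hη
  have hη0 : 0 < η := div_pos hτ (by positivity)
  have hηV : η * (1 + V) = τ / 2 := by
    rw [hη]
    field_simp
  calc Var[X; ν] ≤ η + (1 + η) * V := key' η hη0
    _ = V + η * (1 + V) := by ring
    _ < V + τ := by rw [hηV]; linarith

end VarianceApprox

/-! ## The reduction to smooth Lipschitz observables -/

section SmoothPoincare

variable {d N : ℕ}

attribute [local instance] Matrix.frobeniusSeminormedAddCommGroup Matrix.frobeniusNormedAddCommGroup
  Matrix.frobeniusNormedSpace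

/-- With the (local) Frobenius norm on `M_N(ℂ)`, `frobNorm (a - b)` is the distance. [folklore] -/
theorem frobNorm_sub_eq_dist (a b : Matrix (Fin N) (Fin N) ℂ) : frobNorm (a - b) = dist a b := by
  rw [frobNorm_eq_norm, dist_eq_norm]

/-- **Shen–Zhu–Zhu from the smooth one-link Poincaré inequality.**  Suppose that for `N ≥ 2` and
every `B ∈ M_N(ℂ)` with `‖B‖_op < 1/2`, the one-link measure
`ν_B(dg) = Z_B⁻¹ exp(N Re tr(g B)) dHaar(g)` on `SU(N)` satisfies
`Var_{ν_B}(f|_{SU(N)}) ≤ M² / (N (1/2 - ‖B‖_op))` for every **smooth** (`C^∞` on the real vector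
space `M_N(ℂ)`) function `f : M_N(ℂ) → ℝ` that is `M`-Lipschitz for the Frobenius distance
(hypothesis `hSP`; this is the output of the Bakry–Émery Γ₂-argument, Shen–Zhu–Zhu (4.7) ⇒
Cor. 4.4 (4.11), arXiv:2204.12737v1 p. 19 /
Bakry–Gentil–Ledoux Prop. 4.8.1, combined with `|∇f|_{SU(N)}|² ≤ ‖Df‖² ≤ M²`).  Then
`shen_zhu_zhu d N` holds.

Proof: by `shen_zhu_zhu_of_haarPoincare` it suffices to bound `Var_{ν_B}(ψ)` for every
`ψ : SU(N) → ℝ` with `|ψ a - ψ b| ≤ M ‖a - b‖_F`.  Extend `ψ` to an `M`-Lipschitz function on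
`M_N(ℂ)` (McShane, `LipschitzOnWith.extend_real`), mollify it into smooth `M`-Lipschitz functions
uniformly `ε`-close to `ψ` on `SU(N)` (`exists_contDiff_lipschitzWith_dist_le`), apply `hSP` to
each, and let `ε → 0` (`variance_le_of_forall_approx`).
[cite: arXiv220412737, Assumption 1.1, Lemma 4.1, (4.7)–(4.8), Cor. 4.4 (4.11), Thm. 1.2, Cor. 1.6 (Mass gap)] -/
theorem shen_zhu_zhu_of_smoothPoincare
    (hSP : 2 ≤ N → ∀ B : Matrix (Fin N) (Fin N) ℂ, matrixOpNorm B < 1 / 2 →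
      ∀ (f : Matrix (Fin N) (Fin N) ℂ → ℝ) (M : ℝ), 0 ≤ M → ContDiff ℝ ∞ f →
        (∀ a b, |f a - f b| ≤ M * frobNorm (a - b)) →
        Var[fun g : Matrix.specialUnitaryGroup (Fin N) ℂ => f (g : Matrix (Fin N) (Fin N) ℂ);
          (haarProbability (Matrix.specialUnitaryGroup (Fin N) ℂ)).tilted
            fun g => (N : ℝ) * ((g : Matrix (Fin N) (Fin N) ℂ) * B).trace.re] ≤
          M ^ 2 / ((N : ℝ) * (1 / 2 - matrixOpNorm B))) :
    shen_zhu_zhu d N := by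
  refine shen_zhu_zhu_of_haarPoincare fun hN B hB ψ M hM hψ => ?_
  set ν : Measure (Matrix.specialUnitaryGroup (Fin N) ℂ) :=
    (haarProbability (Matrix.specialUnitaryGroup (Fin N) ℂ)).tilted
      fun g => (N : ℝ) * ((g : Matrix (Fin N) (Fin N) ℂ) * B).trace.re with hν
  haveI : IsProbabilityMeasure ν := by
    refine isProbabilityMeasure_tilted ?_
    obtain ⟨C₀, hC₀⟩ : ∃ C₀, ∀ g : Matrix.specialUnitaryGroup (Fin N) ℂ,
        |(N : ℝ) * ((g : Matrix (Fin N) (Fin N) ℂ) * B).trace.re| ≤ C₀ :=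
      ⟨(N : ℝ) * (Real.sqrt N * frobNorm B), fun g => by
        rw [abs_mul, abs_of_nonneg (Nat.cast_nonneg _)]
        exact mul_le_mul_of_nonneg_left (abs_re_trace_su_mul_le g B) (Nat.cast_nonneg _)⟩
    refine QuantumLattice.integrable_of_bound (C := Real.exp C₀) ?_ fun g => ?_
    · exact (Real.continuous_exp.comp
        (continuous_const.mul (continuous_re_trace_su_mul B))).aestronglyMeasurable
    · rw [abs_of_nonneg (Real.exp_pos _).le]
      exact Real.exp_le_exp.2 ((le_abs_self _).trans (hC₀ g))
  -- `ψ` is `M`-Lipschitz for the (Frobenius) subspace distance, hence continuous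
  set K : ℝ≥0 := ⟨M, hM⟩ with hK
  have hψL : LipschitzWith K ψ := by
    refine LipschitzWith.of_dist_le_mul fun a b => ?_
    rw [Real.dist_eq, Subtype.dist_eq, ← frobNorm_sub_eq_dist]
    exact hψ a b
  -- (continuity for the standard topology of `SU(N)`, definitionally the Frobenius one)
  have hψc : Continuous ψ := hψL.continuous
  -- McShane extension to the ambient matrix space
  obtain ⟨F, hFL, hFψ⟩ : ∃ F : Matrix (Fin N) (Fin N) ℂ → ℝ, LipschitzWith K F ∧
      ∀ g : Matrix.specialUnitaryGroup (Fin N) ℂ, F g = ψ g := by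
    classical
    let f₀ : Matrix (Fin N) (Fin N) ℂ → ℝ := fun A =>
      if h : A ∈ Matrix.specialUnitaryGroup (Fin N) ℂ then ψ ⟨A, h⟩ else 0
    have hf₀ : LipschitzOnWith K f₀ (Matrix.specialUnitaryGroup (Fin N) ℂ : Set _) := by
      refine LipschitzOnWith.of_dist_le_mul fun a ha b hb => ?_
      have ha' : a ∈ Matrix.specialUnitaryGroup (Fin N) ℂ := ha
      have hb' : b ∈ Matrix.specialUnitaryGroup (Fin N) ℂ := hb
      simp only [f₀, dif_pos ha', dif_pos hb', Real.dist_eq]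
      refine (hψ ⟨a, ha'⟩ ⟨b, hb'⟩).trans (le_of_eq ?_)
      rw [suFrobDist, frobNorm_sub_eq_dist]
      rfl
    obtain ⟨F, hFL, hF⟩ := hf₀.extend_real
    refine ⟨F, hFL, fun g => ?_⟩
    rw [← hF g.2]
    simp [f₀]
  -- approximate and conclude
  refine variance_le_of_forall_approx hψc.aestronglyMeasurable ?_ fun ε hε => ?_
  · obtain ⟨C, hC⟩ := (isCompact_univ.image hψc).isBounded.subset_closedBall 0 |>.imp
      fun C h => h
    refine ⟨max C 0, fun g => ?_⟩
    have := hC ⟨g, Set.mem_univ _, rfl⟩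
    rw [Metric.mem_closedBall, Real.dist_eq, sub_zero] at this
    exact this.trans (le_max_left _ _)
  · obtain ⟨G, hGs, hGL, hGF⟩ := exists_contDiff_lipschitzWith_dist_le hFL hε
    have hGc : Continuous G := hGs.continuous
    refine ⟨fun g => G (g : Matrix (Fin N) (Fin N) ℂ), ?_, fun g => ?_, ?_⟩
    · exact (hGc.comp continuous_subtype_val).aestronglyMeasurable
    · rw [← hFψ g, abs_sub_comm, ← Real.dist_eq]
      exact hGF _
    · refine hSP hN B hB G M hM hGs fun a b => ?_
      rw [← Real.dist_eq, frobNorm_sub_eq_dist]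
      exact hGL.dist_le_mul a b

end SmoothPoincare

end Literature.MathematicalPhysics.QuantumFieldTheory
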